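import Literature.AlgebraicGeometry.HodgeTheory.GenericFibreClosedSubsetSpread
import HarnessLib

/-!
# Spreading a closed subset of the fibre over a generic complex point — integral base

`exists_spread_isClosed_fiberOver_generic` (the affine case) extended to an arbitrary integral base
`S₀`: restrict the family to an affine open neighbourhood `U₀` of the generic point (the complex
point `s` over the generic point factors through `U₀ ⊗ ℂ`, and the fibre does not change:
`exists_fiberOver_iso_of_isPullback` for the cartesian square of the restriction), spread there,
and compose with the open immersion `U₀ ⊆ S₀` (Charles–Schnell, *Notes on absolute Hodge classes*,
§11.3.3, Remark after Cor. 11.3.16; Görtz–Wedhorn I, Prop. 4.16 and Thm. 10.57).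
-/

noncomputable section

open CategoryTheory CategoryTheory.Limits AlgebraicGeometry TopologicalSpace Opposite

set_option backward.isDefEq.respectTransparency false

namespace Literature.AlgebraicGeometry.HodgeTheory

open Literature.AlgebraicGeometry.Motives

section Spread

variable {k : Type} [Field k] (σ : k →+* ℂ) {𝒳₀ S₀ : SchemeOver k} (f₀ : 𝒳₀ ⟶ S₀)

/-- The complement of the preimage of a set with compact complement under an isomorphism of schemes
is compact. [folklore] -/
private theorem isCompact_compl_preimage_of_iso {X Y : Scheme} (e : X ≅ Y) {V : Set Y}
    (hVc : IsCompact Vᶜ) : IsCompact (e.hom ⁻¹' V)ᶜ := by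
  rw [← Set.preimage_compl]
  exact (Scheme.homeoOfIso e).isCompact_preimage.2 hVc

/-- **Spread of a closed subset of the fibre over a complex point lying over the generic point of an
integral base** (`exists_spread_isClosed_fiberOver_generic` without the affineness hypothesis on
`S₀`): for `f₀ : 𝒳₀ ⟶ S₀` over `k` with `S₀` integral, `s` a complex point of `S₀ ⊗_σ ℂ` over the
generic point of `S₀` and `V ⊆ (f₀ ⊗ ℂ)⁻¹(s)` closed with quasi-compact complement, there are an
integral affine `T₀`, a dominant `h₀ : T₀ ⟶ S₀` locally of finite type, a cartesian square
`(q₀, g₀; f₀, h₀)`, a closed `Z ⊆ 𝒲₀`, a complex point `t` of `T₀ ⊗ ℂ` over the generic point of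
`T₀` with `h(t) = s`, and an isomorphism over `Spec ℂ` of the fibre of `g₀ ⊗ ℂ` over `t` with the
fibre of `f₀ ⊗ ℂ` over `s`, compatible with the inclusions, carrying the slice of `Z` onto `V`.
[cite: CharlesSchnell2014Notes, Remark after Cor. 11.3.16 and Lemma 11.3.14]
[cite: GortzWedhorn2020, Prop. 4.16 and Thm. 10.57] -/
theorem exists_spread_isClosed_fiberOver_generic_of_isIntegral [IsIntegral S₀.left]
    (s : ComplexPoints ((baseChangeHom σ).obj S₀))
    (hs : baseChangeHomFst σ S₀ s.pt = genericPoint S₀.left)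
    {V : Set (fiberOver ((baseChangeHom σ).map f₀) s).left} (hV : IsClosed V) (hVc : IsCompact Vᶜ) :
    ∃ (T₀ 𝒲₀ : SchemeOver k) (_ : IsAffine T₀.left) (_ : IsIntegral T₀.left) (h₀ : T₀ ⟶ S₀)
      (_ : LocallyOfFiniteType h₀.left) (_ : IsDominant h₀.left)
      (g₀ : 𝒲₀ ⟶ T₀) (q₀ : 𝒲₀ ⟶ 𝒳₀) (Z : Set 𝒲₀.left)
      (t : ComplexPoints ((baseChangeHom σ).obj T₀))
      (e : fiberOver ((baseChangeHom σ).map g₀) t ≅ fiberOver ((baseChangeHom σ).map f₀) s),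
      IsPullback q₀.left g₀.left f₀.left h₀.left ∧ IsClosed Z ∧
      AlgPoints.map ((baseChangeHom σ).map h₀) t = s ∧
      baseChangeHomFst σ T₀ t.pt = genericPoint T₀.left ∧
      e.hom ≫ fiberι ((baseChangeHom σ).map f₀) s =
        fiberι ((baseChangeHom σ).map g₀) t ≫ (baseChangeHom σ).map q₀ ∧
      e.hom.left ⁻¹' V =
        ((fiberι ((baseChangeHom σ).map g₀) t).left ≫ baseChangeHomFst σ 𝒲₀) ⁻¹' Z := by
  classical
  letI := σ.toAlgebra
  -- ### an affine open neighbourhood of the generic point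
  obtain ⟨_, ⟨U₀', hU₀, rfl⟩, hηU₀', -⟩ := S₀.left.isBasis_affineOpens.exists_subset_of_mem_open
    (Set.mem_univ (genericPoint S₀.left)) isOpen_univ
  let U₀ : S₀.left.Opens := U₀'
  have hηU₀ : genericPoint S₀.left ∈ U₀ := hηU₀'
  haveI : Nonempty U₀.toScheme := ⟨⟨_, hηU₀⟩⟩
  haveI : Subsingleton ↥(specOver ℂ ℂ).left := inferInstanceAs (Subsingleton (PrimeSpectrum ℂ))
  -- ### the restricted family over `k` and the cartesian square of the restriction
  let S₀' : SchemeOver k := Over.mk (U₀.ι ≫ S₀.hom)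
  haveI : IsAffine S₀'.left := hU₀
  haveI hS₀'int : IsIntegral S₀'.left := inferInstanceAs (IsIntegral U₀.toScheme)
  let j : S₀' ⟶ S₀ := Over.homMk U₀.ι rfl
  let 𝒳₀' : SchemeOver k := Over.mk ((f₀.left ⁻¹ᵁ U₀).ι ≫ 𝒳₀.hom)
  let i : 𝒳₀' ⟶ 𝒳₀ := Over.homMk (f₀.left ⁻¹ᵁ U₀).ι rfl
  have hf₀'w : (f₀.left ∣_ U₀) ≫ S₀'.hom = 𝒳₀'.hom := by
    change (f₀.left ∣_ U₀) ≫ U₀.ι ≫ S₀.hom = (f₀.left ⁻¹ᵁ U₀).ι ≫ 𝒳₀.hom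
    rw [← Category.assoc, morphismRestrict_ι, Category.assoc, Over.w f₀]
  let f₀' : 𝒳₀' ⟶ S₀' := Over.homMk (f₀.left ∣_ U₀) hf₀'w
  have Hres : IsPullback i.left f₀'.left f₀.left j.left := (isPullback_morphismRestrict f₀.left U₀).flip
  have HresC := isPullback_baseChangeHom_map_of_isPullback' σ Hres
  -- ### `s` factors through the open `U₀ ⊗ ℂ ⊆ S₀ ⊗ ℂ`
  have Hj : IsPullback ((baseChangeHom σ).map j).left (baseChangeHomFst σ S₀')
      (baseChangeHomFst σ S₀) j.left := isPullback_baseChange_map_left ℂ j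
  haveI : IsOpenImmersion ((baseChangeHom σ).map j).left :=
    MorphismProperty.of_isPullback (P := @IsOpenImmersion) Hj.flip
      (inferInstanceAs (IsOpenImmersion U₀.ι))
  have hrange : Set.range s.left ⊆ Set.range ((baseChangeHom σ).map j).left := by
    rintro _ ⟨x, rfl⟩
    obtain rfl : x = IsLocalRing.closedPoint ℂ := Subsingleton.elim _ _
    change s.pt ∈ Set.range ((baseChangeHom σ).map j).left
    obtain ⟨z, hz, -⟩ := Scheme.Pullback.exists_preimage_pullback (f := baseChangeHomFst σ S₀)
      (g := j.left) s.pt ⟨genericPoint S₀.left, hηU₀⟩ (by rw [hs]; rfl)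
    refine ⟨Hj.isoPullback.inv z, ?_⟩
    rw [← hz, ← Scheme.Hom.comp_apply, IsPullback.isoPullback_inv_fst]
  obtain ⟨s', rfl⟩ : ∃ s' : ComplexPoints ((baseChangeHom σ).obj S₀'),
      AlgPoints.map ((baseChangeHom σ).map j) s' = s := by
    refine ⟨Over.homMk (IsOpenImmersion.lift ((baseChangeHom σ).map j).left s.left hrange) ?_, ?_⟩
    · rw [← Over.w ((baseChangeHom σ).map j), ← Category.assoc, IsOpenImmersion.lift_fac]
      exact Over.w s
    · ext : 1
      exact IsOpenImmersion.lift_fac _ _ _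
  -- `s'` lies over the generic point of `U₀`
  have hs' : baseChangeHomFst σ S₀' s'.pt = genericPoint S₀'.left := by
    apply U₀.ι.injective
    have hη : U₀.ι (genericPoint S₀'.left) = genericPoint S₀.left :=
      genericPoint_eq_of_isOpenImmersion (X := S₀'.left) U₀.ι
    rw [hη]
    change j.left (baseChangeHomFst σ S₀' s'.pt) = genericPoint S₀.left
    rw [← Scheme.Hom.comp_apply, ← Hj.w, Scheme.Hom.comp_apply]
    exact hs
  -- ### the fibre over `s'` is the fibre over `s`
  obtain ⟨ε, hε⟩ := exists_fiberOver_iso_of_isPullback HresC s'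
  let V' : Set (fiberOver ((baseChangeHom σ).map f₀') s').left := ε.hom.left ⁻¹' V
  have hV' : IsClosed V' := hV.preimage ε.hom.left.continuous
  have hV'c : IsCompact V'ᶜ := isCompact_compl_preimage_of_iso ((Over.forget _).mapIso ε) hVc
  -- ### spread over the affine open
  obtain ⟨T₀, 𝒲₀, hT₀aff, hT₀int, h₀', hlft', hdom', g₀, q₀', Z, t, e', Hsq', hZ, hts', hgen,
    hcomp', hslice'⟩ := exists_spread_isClosed_fiberOver_generic σ f₀' s' hs' hV' hV'c
  -- ### conclusion
  haveI := hlft'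
  haveI := hdom'
  haveI : IsDominant U₀.ι := by
    refine ⟨?_⟩
    change Dense (Set.range U₀.ι)
    rw [Scheme.Opens.range_ι]
    intro x
    have hη : x ∈ closure ({genericPoint S₀.left} : Set S₀.left) := by
      rw [genericPoint_closure]; trivial
    exact closure_mono (Set.singleton_subset_iff.2 hηU₀) hη
  refine ⟨T₀, 𝒲₀, hT₀aff, hT₀int, h₀' ≫ j, inferInstanceAs (LocallyOfFiniteType (h₀'.left ≫ U₀.ι)),
    inferInstanceAs (IsDominant (h₀'.left ≫ U₀.ι)), g₀, q₀' ≫ i, Z, t, e' ≪≫ ε,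
    Hsq'.paste_horiz Hres, hZ, ?_, hgen, ?_, ?_⟩
  · -- `h(t) = s`
    change t ≫ (baseChangeHom σ).map (h₀' ≫ j) = s' ≫ (baseChangeHom σ).map j
    rw [Functor.map_comp, ← Category.assoc]
    exact congrArg (· ≫ (baseChangeHom σ).map j) hts'
  · -- compatibility with the inclusions
    rw [Iso.trans_hom, Category.assoc, hε, ← Category.assoc, hcomp', Category.assoc,
      ← Functor.map_comp]
  · -- the slice
    rw [Iso.trans_hom, Over.comp_left, Scheme.Hom.comp_base, TopCat.coe_comp, Set.preimage_comp]
    exact hslice'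

end Spread

end Literature.AlgebraicGeometry.HodgeTheory

end
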